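import Literature.Computability.Complexity.CodeFPBudgets
import Literature.Computability.Complexity.RatBricks
import Literature.Algebra.EuclideanLattices.Encoding
import HarnessLib

/-!
# Typed polynomial time on codes: exact rational arithmetic in the `encodeRat` format

Toolkit file between the brick algebra of exact rationals (`RatBricks.lean`: `Brick.qnormF`, lowest
terms; `ZIntBricks.lean`: difference-pair integers) and the typed `CodeFP` algebra (`CodeFP.lean`,
`CodeFPArith.lean`, `CodeFPBudgets.lean`). The code of a rational is the tree's canonical one,
`encodeRat q = ⟨smE (num q), bin (den q)⟩` (`Literature.Algebra.EuclideanLattices.encodeRat`, the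
`encode` of `encodingRatBool`: lowest-terms numerator in sign–magnitude, denominator in binary) —
literally the value format of `IsPComputable` martingales (`ResourceBoundedMeasure.lean`) and of
the rational parameters of the LWE trunk (`CodeFPOfUnary.codeFP_ratParam`). This file TYPES exact
rational arithmetic as `CodeFP` facts between `encodeRat`-coded rationals, so that a rational-valued
functional program (first client: the union martingale of Lutz's E-uniform union lemma,
`ResourceBoundedMeasureFactsProofs.lean`) is assembled from combinators with no machine written:

* `CodeFP.encodeRat_eq_pairE`, `CodeFP.ratNumDen` (`q ↦ (num q, den q)` into `pairE intE natE`),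
  **`CodeFP.ratOfIntNat`** (`(Z, M) ↦ Z / M` in lowest terms, `Z / 0 = 0` as in `ℚ`);
* `CodeFP.ratAdd` (cross-multiplication), `CodeFP.ratMul`, `CodeFP.ratInv`
  (`q⁻¹ = (den q · num q) / |num q|²`, `0⁻¹ = 0`), `CodeFP.ratDiv`, `CodeFP.ratEq`;
* **`CodeFP.ratSum`** — exact sums of raw lists of rationals, a fold of `ratAdd` whose accumulator
  is polynomially bounded because the denominator of a partial sum divides the product of the
  denominators and `|num| ≤ (Σ_j |num_j|) · Π_j den_j` (`den_listSum_dvd_prod_den`,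
  `natAbs_num_le`).

Everything is proved; the only growth estimate is the accumulator bound of `ratSum`
(`|encodeRat (Σ l₁)| ≤ 3L² + 4L + 13`, `L` the length of the list code). Not here: comparisons
`<`/`≤` (cross-multiply with `intLt`), floor/round (`Brick.qroundF` exists as a brick).

## References

* D. E. Knuth, *The Art of Computer Programming*, Vol. 2, 3rd ed., Addison-Wesley 1998, §4.5.1
  (arithmetic of fractions in lowest terms). (Schoolbook; the bricks are proved in the tree.)
* S. Arora, B. Barak, *Computational Complexity: A Modern Approach*, CUP 2009, §1.3 (closure of
  polynomial time under composition and polynomially bounded loops).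
-/

namespace Literature.Computability.Complexity

open _root_.Computability

namespace CodeFP

open Brick Polynomial
open Literature.Algebra.EuclideanLattices (encodeRat encodeRat_injective)

/-! ### The code and its fields -/

/-- `encodeRat q = ⟨smE (num q), bin (den q)⟩` as a typed pair code. [folklore] -/
theorem encodeRat_eq_pairE (q : ℚ) : encodeRat q = pairE smE natE (q.num, q.den) := rfl

/-- Numerator (recoded as a difference pair) and denominator of a rational code. [folklore] -/
theorem ratNumDen : CodeFP encodeRat (pairE intE natE) (fun q => (q.num, q.den)) := by
  have h : CodeFP encodeRat (pairE smE natE) (fun q => (q.num, q.den)) :=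
    ⟨id, PolyTimeComputable.id _, fun _ => rfl⟩
  exact ((intOfSM.comp h.fst').pair h.snd' :)

/-- **The fraction `Z / M` in lowest terms** (`Brick.qnormF` after forcing a positive denominator,
then a branch on `M = 0`; `Z / 0 = 0` as in `ℚ`). [cite: KnuthTAOCP2, §4.5.1] -/
theorem ratOfIntNat : CodeFP (pairE intE natE) encodeRat (fun p => (p.1 : ℚ) / (p.2 : ℚ)) := by
  have hq : CodeFP (fun s : {p : ℤ × ℕ // 0 < p.2} => pairE intE natE s.1) (pairE intE natE)
      (fun s => (((s.1.1 : ℚ) / (s.1.2 : ℚ)).num, ((s.1.1 : ℚ) / (s.1.2 : ℚ)).den)) :=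
    of_fn qnormF qnormF_mem_FP fun s => by
      rw [pairE_apply, pairE_apply]
      exact qnormF_dpEnc s.1.1 s.2
  have h1 : CodeFP (pairE intE natE) (fun s : {p : ℤ × ℕ // 0 < p.2} => pairE intE natE s.1)
      (fun p => ⟨(p.1, max p.2 1), lt_max_of_lt_right one_pos⟩) :=
    ((fst intE natE).pair (natMax.comp ((snd intE natE).pair (const _ 1)))).recodeOut fun _ => rfl
  have h2 := hq.comp h1
  have h3 : CodeFP (pairE intE natE) encodeRat (fun p => (p.1 : ℚ) / ((max p.2 1 : ℕ) : ℚ)) :=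
    ((smOfInt.comp h2.fst').pair h2.snd').recodeOut fun _ => rfl
  have hz : CodeFP (pairE intE natE) bitE (fun p => decide (p.2 = 0)) :=
    (natEq.comp ((snd intE natE).pair (const _ 0)) :)
  refine (hz.ite (const _ (0 : ℚ)) h3).congr fun p => ?_
  by_cases hp : p.2 = 0
  · simp [hp]
  · rw [if_neg (by simpa using hp), Nat.max_eq_left (Nat.one_le_iff_ne_zero.2 hp)]

/-! ### Field operations -/

/-- **Exact addition of rationals on codes**: `(num₁ den₂ + num₂ den₁) / (den₁ den₂)` reduced
(cross-multiplication; cf. the brick `Brick.qaddSMF` of `ResourceBoundedMeasureClosure.lean`).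
[cite: KnuthTAOCP2, §4.5.1] -/
theorem ratAdd : CodeFP (pairE encodeRat encodeRat) encodeRat (fun p => p.1 + p.2) := by
  have ha : CodeFP (pairE encodeRat encodeRat) (pairE intE natE) (fun p => (p.1.num, p.1.den)) :=
    (ratNumDen.comp (fst _ _) :)
  have hb : CodeFP (pairE encodeRat encodeRat) (pairE intE natE) (fun p => (p.2.num, p.2.den)) :=
    (ratNumDen.comp (snd _ _) :)
  have hnum : CodeFP (pairE encodeRat encodeRat) intE
      (fun p => p.1.num * (p.2.den : ℤ) + p.2.num * (p.1.den : ℤ)) :=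
    (intAdd.comp ((intMul.comp (ha.fst'.pair (intOfNat.comp hb.snd'))).pair
      (intMul.comp (hb.fst'.pair (intOfNat.comp ha.snd')))) :)
  refine ((ratOfIntNat.comp (hnum.pair (natMul.comp (ha.snd'.pair hb.snd')))).congr fun p => ?_)
  show ((p.1.num * (p.2.den : ℤ) + p.2.num * (p.1.den : ℤ) : ℤ) : ℚ) / ((p.1.den * p.2.den : ℕ) : ℚ)
    = p.1 + p.2
  have h1 : (p.1.den : ℚ) ≠ 0 := Nat.cast_ne_zero.2 p.1.den_nz
  have h2 : (p.2.den : ℚ) ≠ 0 := Nat.cast_ne_zero.2 p.2.den_nz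
  conv_rhs => rw [← Rat.num_div_den p.1, ← Rat.num_div_den p.2, div_add_div _ _ h1 h2]
  push_cast
  ring

/-- **Exact multiplication of rationals on codes**: `(num₁ num₂) / (den₁ den₂)` reduced.
[cite: KnuthTAOCP2, §4.5.1] -/
theorem ratMul : CodeFP (pairE encodeRat encodeRat) encodeRat (fun p => p.1 * p.2) := by
  have ha : CodeFP (pairE encodeRat encodeRat) (pairE intE natE) (fun p => (p.1.num, p.1.den)) :=
    (ratNumDen.comp (fst _ _) :)
  have hb : CodeFP (pairE encodeRat encodeRat) (pairE intE natE) (fun p => (p.2.num, p.2.den)) :=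
    (ratNumDen.comp (snd _ _) :)
  refine ((ratOfIntNat.comp ((intMul.comp (ha.fst'.pair hb.fst')).pair
    (natMul.comp (ha.snd'.pair hb.snd')))).congr fun p => ?_)
  show ((p.1.num * p.2.num : ℤ) : ℚ) / ((p.1.den * p.2.den : ℕ) : ℚ) = p.1 * p.2
  rw [Int.cast_mul, Nat.cast_mul, ← div_mul_div_comm, Rat.num_div_den, Rat.num_div_den]

/-- `|z|` cast to `ℚ`. [folklore] -/
theorem natCast_natAbs (z : ℤ) : ((z.natAbs : ℕ) : ℚ) = |(z : ℚ)| := by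
  rw [← Int.cast_natCast, Int.natCast_natAbs, Int.cast_abs]

/-- **Exact inversion of rationals on codes**: `q⁻¹ = (den q · num q) / |num q|²` (and `0⁻¹ = 0`,
both sides). [folklore] -/
theorem ratInv : CodeFP encodeRat encodeRat (fun q => q⁻¹) := by
  have hn : CodeFP encodeRat intE Rat.num := (ratNumDen.fst' :)
  have hd : CodeFP encodeRat natE Rat.den := (ratNumDen.snd' :)
  have ha : CodeFP encodeRat natE (fun q => q.num.natAbs) := (intNatAbs.comp hn :)
  refine ((ratOfIntNat.comp ((intMul.comp ((intOfNat.comp hd).pair hn)).pair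
    (natMul.comp (ha.pair ha)))).congr fun q => ?_)
  show (((q.den : ℤ) * q.num : ℤ) : ℚ) / ((q.num.natAbs * q.num.natAbs : ℕ) : ℚ) = q⁻¹
  rcases eq_or_ne q.num 0 with hz | hz
  · obtain rfl := Rat.num_eq_zero.1 hz
    simp
  · have hq : (q.num : ℚ) ≠ 0 := Int.cast_ne_zero.2 hz
    rw [Int.cast_mul, Int.cast_natCast, Nat.cast_mul, natCast_natAbs, abs_mul_abs_self,
      mul_div_mul_right _ _ hq, ← inv_div, Rat.num_div_den]

/-- Exact division of rationals on codes (`x / 0 = 0` as in `ℚ`). [folklore] -/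
theorem ratDiv : CodeFP (pairE encodeRat encodeRat) encodeRat (fun p => p.1 / p.2) :=
  (ratMul.comp ((fst _ _).pair (ratInv.comp (snd _ _)))).congr fun p =>
    (div_eq_mul_inv p.1 p.2).symm

/-- Equality of rationals, decided on codes (the code is injective). [folklore] -/
theorem ratEq : CodeFP (pairE encodeRat encodeRat) bitE (fun p => decide (p.1 = p.2)) :=
  eq encodeRat_injective

/-! ### Sums of lists of rationals -/

/-- Length of a rational code: `2 size |num q| + size (den q) + 10`. [folklore] -/
theorem length_encodeRat (q : ℚ) :
    (encodeRat q).length = 2 * Nat.size q.num.natAbs + Nat.size q.den + 10 := by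
  rw [show encodeRat q = boolPair (boolPair [decide (q.num < 0)] (encodeNat q.num.natAbs))
      (encodeNat q.den) from rfl, length_boolPair, length_boolPair,
    TM2Pass.length_encodeNat_eq_size, TM2Pass.length_encodeNat_eq_size, List.length_singleton]
  omega

/-- The denominator of a sum divides the product of the denominators. [folklore] -/
theorem den_listSum_dvd_prod_den (l : List ℚ) : l.sum.den ∣ (l.map Rat.den).prod := by
  induction l with
  | nil => simp
  | cons a l ih =>
    rw [List.sum_cons, List.map_cons, List.prod_cons]
    exact (Rat.add_den_dvd a l.sum).trans (Nat.mul_dvd_mul_left _ ih)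

/-- `|q| ≤ |num q|` (`den q ≥ 1`). [folklore] -/
theorem abs_le_natAbs_num (q : ℚ) : |q| ≤ (q.num.natAbs : ℚ) := by
  rw [natCast_natAbs, ← Rat.mul_den_eq_num, abs_mul, Nat.abs_cast]
  exact le_mul_of_one_le_right (abs_nonneg q) (by exact_mod_cast q.den_pos)

/-- `|Σ l| ≤ Σ_{q ∈ l} |num q|`. [folklore] -/
theorem abs_sum_le_sum_natAbs_num (l : List ℚ) :
    |l.sum| ≤ ((l.map fun q => q.num.natAbs).sum : ℕ) := by
  induction l with
  | nil => simp
  | cons a l ih =>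
    rw [List.sum_cons, List.map_cons, List.sum_cons, Nat.cast_add]
    exact (abs_add_le _ _).trans (add_le_add (abs_le_natAbs_num a) ih)

/-- Bounds on `|s|` and `den s` bound `|num s| = |s| · den s`. [folklore] -/
theorem natAbs_num_le {s : ℚ} {A D : ℕ} (h1 : |s| ≤ A) (h2 : s.den ≤ D) : s.num.natAbs ≤ A * D := by
  have h : (s.num.natAbs : ℚ) ≤ A * D := by
    rw [natCast_natAbs, ← Rat.mul_den_eq_num, abs_mul, Nat.abs_cast]
    exact mul_le_mul h1 (by exact_mod_cast h2) (Nat.cast_nonneg _) (Nat.cast_nonneg _)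
  exact_mod_cast h

/-- Size of the product of a list of numerals of bounded size. [folklore] -/
theorem size_listProd_le {l : List ℕ} {M : ℕ} (h : ∀ x ∈ l, Nat.size x ≤ M) :
    Nat.size l.prod ≤ l.length * M + 1 := by
  induction l with
  | nil => simp
  | cons a l ih =>
    rw [List.prod_cons, List.length_cons]
    have ha := h a List.mem_cons_self
    have hl := ih fun x hx => h x (List.mem_cons_of_mem _ hx)
    have := size_mul_le a l.prod
    rw [Nat.succ_mul]
    omega

/-- **Exact sums of raw lists of rationals** (a fold of `ratAdd`, identified with `List.sum` by
`List.sum_eq_foldl` / `List.foldl_eq_apply_foldr`; the partial sums stay short: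
`|encodeRat (Σ l₁)| ≤ 3L² + 4L + 13` for `L` the length of the code of the whole list).
[cite: AroraBarak2009, §1.3 (polynomially bounded loops)] -/
theorem ratSum : CodeFP (rawE encodeRat) encodeRat List.sum := by
  have hstep : CodeFP (pairE encodeRat encodeRat) encodeRat (fun t => t.2 + t.1) :=
    (ratAdd.comp ((snd _ _).pair (fst _ _)) :)
  have h := foldl₀ (step := fun (a : ℚ) acc => acc + a) (b₀ := 0) hstep
    (3 * (X * X) + 4 * X + 13) (fun l₁ l₂ => by
      rw [← List.sum_eq_foldl]
      simp only [eval_add, eval_mul, eval_X, eval_ofNat]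
      set L := (rawE encodeRat (l₁ ++ l₂)).length
      have hitem : ∀ q ∈ l₁, 2 * Nat.size q.num.natAbs + Nat.size q.den + 10 ≤ L := fun q hq => by
        rw [← length_encodeRat]
        exact le_trans (by omega)
          (length_item_le_length_rawE encodeRat (List.mem_append_left l₂ hq))
      have hlen : l₁.length ≤ L := le_trans (by simp) (length_le_length_rawE encodeRat (l₁ ++ l₂))
      have hDpos : 0 < (l₁.map Rat.den).prod := List.prod_pos fun x hx => by
        obtain ⟨q, -, rfl⟩ := List.mem_map.1 hx
        exact q.den_pos
      have hden : l₁.sum.den ≤ (l₁.map Rat.den).prod :=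
        Nat.le_of_dvd hDpos (den_listSum_dvd_prod_den l₁)
      have hD : Nat.size (l₁.map Rat.den).prod ≤ L * L + 1 := by
        refine (size_listProd_le (M := L) fun x hx => ?_).trans ?_
        · obtain ⟨q, hq, rfl⟩ := List.mem_map.1 hx
          have := hitem q hq
          omega
        · rw [List.length_map]
          exact Nat.succ_le_succ (Nat.mul_le_mul_right _ hlen)
      have hA : Nat.size (l₁.map fun q => q.num.natAbs).sum ≤ L + L := by
        refine (size_sum_le (M := L) fun x hx => ?_).trans ?_
        · obtain ⟨q, hq, rfl⟩ := List.mem_map.1 hx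
          have := hitem q hq
          omega
        · rw [List.length_map]
          omega
      have hnum := natAbs_num_le (abs_sum_le_sum_natAbs_num l₁) hden
      have h1 : Nat.size l₁.sum.num.natAbs ≤ (L + L) + (L * L + 1) :=
        (size_mono hnum).trans ((size_mul_le _ _).trans (add_le_add hA hD))
      have h2 : Nat.size l₁.sum.den ≤ L * L + 1 := (size_mono hden).trans hD
      rw [length_encodeRat]
      omega)
  exact h.congr fun l => (List.sum_eq_foldl (xs := l)).symm

end CodeFP

end Literature.Computability.Complexity
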